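import Summits.RiemannHypothesis.RiemannHypothesis.Theorems.TiltedLandingLaw421R3FarStep4

/-! # TiltedLandingLaw421R3FarStep6Sharp — W-08 RATE^B support: the SHARP nested step on the HIGH ZONE (constant 1, not 4/5) (C3 «analysis» rh-idea-3 g42)
PART 6 of the far-step kit, against PART 4 `…R3FarStep4` (`nested_step_energy_eta`, constant `4/5`) and PART 2 `…R3FarStep2` (`normSq_pairQ`,
`crit_field_identity`). IMAGE ONLY (files-only seat; a hand may land it `--supports stmt-RiemannHypothesis-33346 --as helper`).
THE POINT: part 4's header records the sharp POSITION constant `2√2 − 2 ≈ 0.828` (critical configuration `w − a = i(√2 − 1)b`, height `0.414·b`) and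
concludes that `c = 1` is not a consequence of position geometry. It IS — on the HIGH ZONE `b² ≤ (Re w − a)² + 5·Im w²` (every point of the closed disc
at height `≥ b/√5 ≈ 0.447·b`, in particular every successor that dropped `< s/4` from an aloft level `b ≥ 2s`): there
`‖q(w)‖² ≤ (b² − Im w²)·4‖w − a‖²` with EQUALITY on the Jensen circle, by the one-line identity
`4‖w−a‖²(b² − Im w²) − ‖q(w)‖² = (b² − ‖w−a‖²)·(‖w−a‖² + 4·Im w² − b²)` (`sharp_core_gap`). Hence ★★★ `sharp_step_energy_eta`: NESTED + HIGH + `‖K(w)‖ ≤ η/s`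
⇒ `s² ≤ η²·(b² − Im w²)` — the `c = 1` summand (`FarEnergyLawQ` = `FarEnergyLawCQ 1`, `farEnergyLawCQ_one`), NO aloft and NO far clause needed
(the high zone selects the far branch by itself); equivalently `FarEnergyLawCQ (4/5)` already follows from the WEAKER field bound `‖K(w)‖ ≤ (√5/2)·η/s`
(`sharp_step_energy_eta_weak`), an 11.8 % allowance for the «gradient gain» of the cofactor field between the state line and the child (C3 g42 census
`pub/ideators/rh-idea-3/g42/f1neg/F1-level0-census-C3-g42.md`). The critical configuration of part 4 sits at height `0.414·b < b/√5`: no contradiction.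
Sorry-free; Mathlib + parts 2/4 only. Nothing here bears on the truth of RH; RH is NOT proved; 33346 / 33347 OPEN. -/

namespace RhW08.FarStep

open Complex Metric Set
open scoped ComplexConjugate
open RhW08.IsolatedTilt

/-! ## §F.11 THE SHARP STEP on the high zone -/

/-- (K) §F.11 the SHARP CORE GAP identity in the variables `S = ‖w − a‖²`, `t = Im w²`, `B = b²` (`‖q(w)‖² = (S + B)² − 4Bt`, `normSq_pairQ`):
`4S(B − t) − ((S + B)² − 4Bt) = (B − S)(S + 4t − B)`. -/
theorem sharp_core_gap (S t B : ℝ) : (B - t) * (4 * S) - ((S + B) ^ 2 - 4 * B * t) = (B - S) * (S + 4 * t - B) := by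
  ring

/-- ★ (K) §F.11 **THE SHARP CORE INEQUALITY**: NESTED (`S ≤ B`) and HIGH (`B ≤ S + 4t`, i.e. `b² ≤ (Re w − a)² + 5·Im w²`) give
`(S + B)² − 4Bt ≤ (B − t)·4S`, i.e. `‖q(w)‖² ≤ (b² − Im w²)·4‖w − a‖²`. Equality iff `S = B` (the Jensen circle) or `B = S + 4t`. -/
theorem sharp_core_ineq {S t B : ℝ} (hSB : S ≤ B) (hhigh : B ≤ S + 4 * t) :
    (S + B) ^ 2 - 4 * B * t ≤ (B - t) * (4 * S) := by
  nlinarith [mul_nonneg (sub_nonneg.2 hSB) (sub_nonneg.2 hhigh), sharp_core_gap S t B]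

/-- ★★ (K) §F.11 **THE SHARP STEP, POSITION FORM**: a point `w` of the open upper half plane NESTED in the closed disc (`‖w − a‖ ≤ b`), in the HIGH
ZONE (`b² ≤ (Re w − a)² + 5·Im w²`) and with bounded position-field `2‖w − a‖ ≤ M‖q(w)‖` (= `|K(w)| ≤ M` at a critical point) satisfies
`1/M² ≤ b² − Im w²`. Pure position algebra; no far clause, no aloft. -/
theorem sharp_step_position {w : ℂ} {a b M : ℝ} (hw : 0 < w.im) (hM0 : 0 < M)
    (hsign : ‖w - a‖ ≤ b) (hhigh : b ^ 2 ≤ (w.re - a) ^ 2 + 5 * w.im ^ 2) (hM : 2 * ‖w - a‖ ≤ M * ‖pairQ a b w‖) :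
    1 / M ^ 2 ≤ b ^ 2 - w.im ^ 2 := by
  set S : ℝ := ‖w - (a : ℂ)‖ ^ 2 with hS_def
  have hS_eq : S = (w.re - a) ^ 2 + w.im ^ 2 := by
    rw [hS_def, ← Complex.normSq_eq_norm_sq, Complex.normSq_apply, Complex.sub_re, Complex.sub_im, Complex.ofReal_re,
      Complex.ofReal_im, sub_zero]
    ring
  have hP : ‖pairQ a b w‖ ^ 2 = (S + b ^ 2) ^ 2 - 4 * b ^ 2 * w.im ^ 2 := by
    rw [← Complex.normSq_eq_norm_sq, normSq_pairQ, Complex.normSq_eq_norm_sq]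
  have hb : 0 ≤ b := (norm_nonneg _).trans hsign
  have hSB : S ≤ b ^ 2 := by
    rw [hS_def]
    have := mul_self_le_mul_self (norm_nonneg _) hsign
    nlinarith [this]
  have hhigh' : b ^ 2 ≤ S + 4 * w.im ^ 2 := by rw [hS_eq]; linarith
  have hcore : ‖pairQ a b w‖ ^ 2 ≤ (b ^ 2 - w.im ^ 2) * (4 * S) := by rw [hP]; exact sharp_core_ineq hSB hhigh'
  have hS0 : 0 < S := by rw [hS_eq]; nlinarith [sq_nonneg (w.re - a), mul_pos hw hw]
  have hM2 : 4 * S ≤ M ^ 2 * ‖pairQ a b w‖ ^ 2 := by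
    have h0 : 0 ≤ 2 * ‖w - (a : ℂ)‖ := by positivity
    have := mul_self_le_mul_self h0 hM
    rw [hS_def]; nlinarith [this]
  have h3 : 4 * S ≤ M ^ 2 * ((b ^ 2 - w.im ^ 2) * (4 * S)) :=
    le_trans hM2 (mul_le_mul_of_nonneg_left hcore (sq_nonneg M))
  have h4 : 1 ≤ M ^ 2 * (b ^ 2 - w.im ^ 2) := by
    by_contra hlt
    rw [not_le] at hlt
    have : M ^ 2 * ((b ^ 2 - w.im ^ 2) * (4 * S)) < 1 * (4 * S) := by
      rw [← mul_assoc]; exact mul_lt_mul_of_pos_right hlt (by linarith)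
    linarith
  rw [div_le_iff₀ (by positivity)]
  linarith [h4]

/-- (K) §F.11 the HIGH ZONE from a height bound without square roots: `b ≤ 2·Im w` ⇒ `b² ≤ (Re w − a)² + 5·Im w²`. -/
theorem highZone_of_half_height {w : ℂ} {a b : ℝ} (hb : 0 ≤ b) (hy : b ≤ 2 * w.im) :
    b ^ 2 ≤ (w.re - a) ^ 2 + 5 * w.im ^ 2 := by
  nlinarith [sq_nonneg (w.re - a), mul_le_mul hy hy hb (by linarith), sq_nonneg w.im]

/-- (K) §F.11 the HIGH ZONE from the sharp height bound `b/√5 ≤ Im w`. -/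
theorem highZone_of_height {w : ℂ} {a b : ℝ} (hb : 0 ≤ b) (hy : b / Real.sqrt 5 ≤ w.im) :
    b ^ 2 ≤ (w.re - a) ^ 2 + 5 * w.im ^ 2 := by
  have h5 : (0 : ℝ) < Real.sqrt 5 := Real.sqrt_pos.2 (by norm_num)
  have hsq : Real.sqrt 5 ^ 2 = 5 := Real.sq_sqrt (by norm_num)
  have h1 : b ≤ w.im * Real.sqrt 5 := by rwa [div_le_iff₀ h5] at hy
  have hy0 : 0 ≤ w.im * Real.sqrt 5 := hb.trans h1
  nlinarith [mul_le_mul h1 h1 hb hy0, sq_nonneg (w.re - a)]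

/-- (K) §F.11 the HIGH ZONE in the books' currency: a successor that dropped `< s/4` (`b − s/4 ≤ Im w`) from an ALOFT level (`2s ≤ b`, e.g. `s/η ≤ b`
with `η ≤ 1/2`) is in the high zone. This is the CHARGED far-level situation (`¬ SuccOf (1/4)`). -/
theorem highZone_of_quarter_drop {w : ℂ} {a b s : ℝ} (hs : 0 ≤ s) (hb : 2 * s ≤ b) (hdrop : b - s / 4 ≤ w.im) :
    b ^ 2 ≤ (w.re - a) ^ 2 + 5 * w.im ^ 2 :=
  highZone_of_half_height (by linarith) (by linarith)

/-- ★★★ (K) §F.11 **THE SHARP NESTED STEP, field form**: `G = q·h` on `ball a ρ`, an UPPER critical point `w` of `G` in the ball with `h w ≠ 0`,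
NESTED `‖w − a‖ ≤ b`, HIGH `b² ≤ (Re w − a)² + 5·Im w²`, field value `K := h′(w)/h(w)` with `‖K‖ ≤ M` ⇒ `1/M² ≤ b² − Im w²`. No aloft, no far clause. -/
theorem sharp_step_energy_of_field {G h : ℂ → ℂ} {a b ρ M : ℝ} (hh : DifferentiableOn ℂ h (ball (a : ℂ) ρ))
    (hG : ∀ z ∈ ball (a : ℂ) ρ, G z = pairQ a b z * h z) {w : ℂ} (hw : w ∈ ball (a : ℂ) ρ) (hhw : h w ≠ 0)
    (hcrit : deriv G w = 0) (hwim : 0 < w.im) (hM0 : 0 < M) (hsign : ‖w - a‖ ≤ b)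
    (hhigh : b ^ 2 ≤ (w.re - a) ^ 2 + 5 * w.im ^ 2) (hKM : ‖deriv h w / h w‖ ≤ M) :
    1 / M ^ 2 ≤ b ^ 2 - w.im ^ 2 := by
  have hid := crit_field_identity hh hG hw hhw hcrit
  have hn : ‖pairQ a b w‖ * ‖deriv h w / h w‖ = 2 * ‖w - a‖ := by
    rw [← norm_mul, hid, norm_neg, norm_mul, Complex.norm_ofNat]
  have hM : 2 * ‖w - a‖ ≤ M * ‖pairQ a b w‖ := by
    rw [← hn, mul_comm]
    exact mul_le_mul_of_nonneg_right hKM (norm_nonneg _)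
  exact sharp_step_position hwim hM0 hsign hhigh hM

/-- ★★★ (K) §F.11 … in the far-law currency `M = η/s`: NESTED + HIGH + `‖K(w)‖ ≤ η/s` ⇒ `s² ≤ η²·(b² − Im w²)` — the `c = 1` summand
(`FarEnergyLawQ`, cf. `farEnergyLawCQ_one`) from the SAME one-point hypothesis as `nested_step_energy_eta`. -/
theorem sharp_step_energy_eta {G h : ℂ → ℂ} {a b ρ η s : ℝ} (hh : DifferentiableOn ℂ h (ball (a : ℂ) ρ))
    (hG : ∀ z ∈ ball (a : ℂ) ρ, G z = pairQ a b z * h z) {w : ℂ} (hw : w ∈ ball (a : ℂ) ρ) (hhw : h w ≠ 0)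
    (hcrit : deriv G w = 0) (hwim : 0 < w.im) (hη : 0 < η) (hs : 0 < s) (hsign : ‖w - a‖ ≤ b)
    (hhigh : b ^ 2 ≤ (w.re - a) ^ 2 + 5 * w.im ^ 2) (hKM : ‖deriv h w / h w‖ ≤ η / s) :
    s ^ 2 ≤ η ^ 2 * (b ^ 2 - w.im ^ 2) := by
  have h1 := sharp_step_energy_of_field hh hG hw hhw hcrit hwim (div_pos hη hs) hsign hhigh hKM
  have hηs : 1 / (η / s) ^ 2 = s ^ 2 / η ^ 2 := by field_simp
  rw [hηs, div_le_iff₀ (by positivity)] at h1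
  linarith

/-- ★★ (K) §F.11 **THE `4/5` LAW FROM THE WEAKER FIELD BOUND**: NESTED + HIGH + `‖K(w)‖ ≤ κ` with `κ² ≤ (5/4)·(η/s)²` (e.g. `κ = (√5/2)·η/s`)
⇒ `(4/5)·s² ≤ η²·(b² − Im w²)`: the `FarEnergyLawCQ (4/5)` summand with an 11.8 % allowance on the cofactor field at the child. -/
theorem sharp_step_energy_eta_weak {G h : ℂ → ℂ} {a b ρ η s κ : ℝ} (hh : DifferentiableOn ℂ h (ball (a : ℂ) ρ))
    (hG : ∀ z ∈ ball (a : ℂ) ρ, G z = pairQ a b z * h z) {w : ℂ} (hw : w ∈ ball (a : ℂ) ρ) (hhw : h w ≠ 0)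
    (hcrit : deriv G w = 0) (hwim : 0 < w.im) (hs : 0 < s) (hκ : 0 < κ) (hsign : ‖w - a‖ ≤ b)
    (hhigh : b ^ 2 ≤ (w.re - a) ^ 2 + 5 * w.im ^ 2) (hKM : ‖deriv h w / h w‖ ≤ κ) (hκη : κ ^ 2 ≤ 5 / 4 * (η / s) ^ 2) :
    4 / 5 * s ^ 2 ≤ η ^ 2 * (b ^ 2 - w.im ^ 2) := by
  have h1 := sharp_step_energy_of_field hh hG hw hhw hcrit hwim hκ hsign hhigh hKM
  rw [div_le_iff₀ (by positivity)] at h1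
  have hηs : (η / s) ^ 2 = η ^ 2 / s ^ 2 := by rw [div_pow]
  rw [hηs, ← mul_div_assoc, le_div_iff₀ (by positivity)] at hκη
  have hE : 0 ≤ b ^ 2 - w.im ^ 2 := by
    by_contra hlt; rw [not_le] at hlt; nlinarith [h1, sq_nonneg κ]
  nlinarith [mul_le_mul_of_nonneg_left hκη hE, h1]

/-- (K) §F.11 **THE CHARGED FAR STEP at `c = 1`** in one call: NESTED + `‖K(w)‖ ≤ η/s` + aloft in the form `2s ≤ b` + quarter-drop `b − s/4 ≤ Im w`
(¬`SuccOf (1/4)` at the successor) ⇒ `s² ≤ η²·(b² − Im w²)`. -/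
theorem charged_step_energy_eta {G h : ℂ → ℂ} {a b ρ η s : ℝ} (hh : DifferentiableOn ℂ h (ball (a : ℂ) ρ))
    (hG : ∀ z ∈ ball (a : ℂ) ρ, G z = pairQ a b z * h z) {w : ℂ} (hw : w ∈ ball (a : ℂ) ρ) (hhw : h w ≠ 0)
    (hcrit : deriv G w = 0) (hwim : 0 < w.im) (hη : 0 < η) (hs : 0 < s) (hsign : ‖w - a‖ ≤ b)
    (hb2 : 2 * s ≤ b) (hdrop : b - s / 4 ≤ w.im) (hKM : ‖deriv h w / h w‖ ≤ η / s) :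
    s ^ 2 ≤ η ^ 2 * (b ^ 2 - w.im ^ 2) :=
  sharp_step_energy_eta hh hG hw hhw hcrit hwim hη hs hsign (highZone_of_quarter_drop hs.le hb2 hdrop) hKM

end RhW08.FarStep
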